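import Summits.Langlands.Langlands.Theses.SqrtFiveQuarticCovers

/-!
# `SqrtFiveQuarticCovers.Assembly` — the route's assembly item (pure glue)

Route `Langlands/SqrtFiveQuarticCovers`, item `Assembly` (stmt-Langlands-17641):
`RefinedLocusModular → ReductionToRefinedLocus → BoxBorelFive → BoxQuartic → SectorComplement →
Langlands`.  This is LITERALLY the type of the route file's certified, sorry-free deciding theorem
`Summit.Langlands.Langlands.Theses.SqrtFiveQuarticCovers.closes`, so the item is settled by naming
it.  HONEST STATUS: pure logic; it proves nothing about modularity of any elliptic curve — the four
modularity binders and the residual `SectorComplement` remain hypotheses (the route's open items).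

References: [Box2022] §7.1; [FreitasLeHungSiksek2015] Remark (iii) after Cor. 2.1 (the sources of
the route's decomposition; no mathematical content of theirs is used here).
-/

set_option linter.dupNamespace false -- project-wide option (lakefile weak.linter.dupNamespace); `Summit.Langlands.Langlands` is the mandated namespace

namespace Summit.Langlands.Langlands.Theorems.SqrtFiveQuarticCovers

open Summit.Langlands.Langlands.Theses.SqrtFiveQuarticCovers

/-- **The assembly item of route `SqrtFiveQuarticCovers` (stmt-Langlands-17641).**  The finite
certificate `RefinedLocusModular`, the reduction `ReductionToRefinedLocus`, Box's Borel-at-5 case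
`BoxBorelFive`, Box's theorem `BoxQuartic` (quartic fields not containing √5) and the declared
residual `SectorComplement` (= `Target → Langlands`) together imply the summit statement
`Langlands`.  Proof: this is the type of the route's deciding theorem `closes` (case split on
`∃ r : K, r ^ 2 = 5`, then on the Borel / H8 ∨ H12 dichotomy at 5, by contradiction with
non-modularity).  Pure glue; unconditional as an implication. -/
theorem assembly_proof : Assembly := by
  unfold Assembly
  intro h₂ h₃ h₄ hB hC
  exact closes h₂ h₃ h₄ hB hC

end Summit.Langlands.Langlands.Theorems.SqrtFiveQuarticCovers
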